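import Summits.QuantumFields.YangMills.Theorems.F4SubCurvatureDoorLaplaceFourierRegistered
import Literature.Analysis.Complex.CrossTheoremNStrips
import Mathlib
import HarnessLib

/-!
# S1 programme (⟨stmt-QuantumFields-23125⟩) — rung R-S1× `CrossAnalyticity` BY NAME

Crux `F4SubCurvatureDoor.RationalToGeneral` ⟨stmt-QuantumFields-23125⟩, owner file `Cruxes/RationalToGeneral/Lines/forward_cone_rungs.lean`
(ns `…ForwardConeRungs`).  This file restates R-S1× `CrossAnalyticity` CHARACTER-IDENTICALLY and proves `crossAnalyticity_holds : CrossAnalyticity`.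

PROOF (transport of the tree's cross theorem).  Put `P(y) = f(x₀ + Σ yⱼ vⱼ)` on the real cube `|yⱼ| < ℓ`, `ℓ = min r (ε / (2(1 + Σ‖vⱼ‖)))`, so the
cube lands in `ball x₀ ε`.  The hypothesis at the point `x₀ + Σ_{j ≠ k} yⱼ vⱼ` in the direction `v_k` is exactly the one-variable holomorphic extension
with uniform bound `M` that `Literature.Analysis.Complex.exists_holomorphic_extension_of_separately_local_fintype` (`ι = Fin 4`) wants (the bound
`‖P‖ ≤ M` on the cube is the case `w = 0`); it returns ONE holomorphic `G` on a polydisc with `G = P` on a real cube, and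
`Literature.Analysis.Complex.analyticAt_of_holomorphic_chart_fintype` with the basis `v` of `ℝ⁴` gives `AnalyticAt ℝ f x₀`.

HONEST LABEL: one rung of the S1 programme; R-S1a/b/d/ℓ, S1, ⟨23125⟩, ⟨23035⟩, R2d and the Yang–Mills mass gap remain OPEN; no summit is proved by
a line.
-/

noncomputable section

open MeasureTheory Filter Topology Set Metric
open scoped BigOperators

namespace Summit.QuantumFields.YangMills.Theorems.F4SubCurvatureDoorCrossAnalyticityRegistered

open Summit.QuantumFields.YangMills.Theorems.F4SubCurvatureDoorLaplaceFourierRegistered (E4)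

/-- R-S1× «CROSS ANALYTICITY» (M–L; Bernstein–Siciak, specialised): a continuous function near `x₀ ∈ ℝ⁴` which, at every nearby point and along each
of four linearly independent directions, extends holomorphically to a disc of FIXED radius with a UNIFORM bound, is real-analytic at `x₀`.  (Linear change
of coordinates to the frame `v`; then the classical lemma on separately holomorphic functions on a real cube with uniform bounded extensions —
Lagrange interpolation / Bernstein–Walsh.)  Used with `v = (e₀, three half-integer short roots)` at points of the positive time axis, fed by
`DirectionalExtension` (radius `t/4`, bound `sup_{[t/4, 2t]}` of the axis function). -/
def CrossAnalyticity : Prop :=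
  ∀ (f : E4 → ℝ) (x₀ : E4) (v : Fin 4 → E4), LinearIndependent ℝ v →
    ∀ (r M ε : ℝ), 0 < r → 0 < ε → ContinuousOn f (Metric.ball x₀ ε) →
      (∀ x : E4, dist x x₀ < ε → ∀ j : Fin 4, ∃ F : ℂ → ℂ, DifferentiableOn ℂ F (Metric.ball 0 r) ∧
          (∀ a : ℝ, |a| < r → F (a : ℂ) = ((f (x + a • v j) : ℝ) : ℂ)) ∧ ∀ w ∈ Metric.ball (0 : ℂ) r, ‖F w‖ ≤ M) →
      AnalyticAt ℝ f x₀

/-- Updating one coordinate of the coefficient vector moves the point along that frame vector. -/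
theorem sum_update_smul (v : Fin 4 → E4) (y : Fin 4 → ℝ) (k : Fin 4) (t : ℝ) :
    ∑ j, Function.update y k t j • v j = (∑ j, Function.update y k 0 j • v j) + t • v k := by
  have h : ∀ j, Function.update y k t j • v j = Function.update y k 0 j • v j + (if j = k then t • v k else 0) := by
    intro j
    by_cases hj : j = k
    · subst hj; simp
    · simp [hj]
  simp only [h, Finset.sum_add_distrib, Finset.sum_ite_eq', Finset.mem_univ, if_true]

/-- A cube of coefficients of side `ℓ` with `ℓ · Σ‖vⱼ‖ < ε` lands in `ball x₀ ε`. -/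
theorem dist_sum_smul_lt (v : Fin 4 → E4) (x₀ : E4) {ℓ ε : ℝ} (hℓε : ℓ * ∑ j, ‖v j‖ < ε)
    (c : Fin 4 → ℝ) (hc : ∀ j, |c j| ≤ ℓ) : dist (x₀ + ∑ j, c j • v j) x₀ < ε := by
  rw [dist_eq_norm, add_sub_cancel_left]
  calc ‖∑ j, c j • v j‖ ≤ ∑ j, ‖c j • v j‖ := norm_sum_le _ _
    _ = ∑ j, |c j| * ‖v j‖ := by simp [norm_smul]
    _ ≤ ∑ j, ℓ * ‖v j‖ := Finset.sum_le_sum fun j _ => mul_le_mul_of_nonneg_right (hc j) (norm_nonneg _)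
    _ = ℓ * ∑ j, ‖v j‖ := (Finset.mul_sum _ _ _).symm
    _ < ε := hℓε

/-- **RUNG R-S1× (by name): `CrossAnalyticity`.** -/
theorem crossAnalyticity_holds : CrossAnalyticity := by
  intro f x₀ v hv r M ε hr hε _ hext
  -- the scale of the real cube
  obtain ⟨S, hS⟩ : ∃ S : ℝ, S = ∑ j, ‖v j‖ := ⟨_, rfl⟩
  have hS0 : 0 ≤ S := by rw [hS]; exact Finset.sum_nonneg fun j _ => norm_nonneg _
  obtain ⟨ℓ, hℓ⟩ : ∃ ℓ : ℝ, ℓ = min r (ε / (2 * (S + 1))) := ⟨_, rfl⟩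
  have hℓpos : 0 < ℓ := by rw [hℓ]; positivity
  have hℓr : ℓ ≤ r := by rw [hℓ]; exact min_le_left _ _
  have hℓε : ℓ * ∑ j, ‖v j‖ < ε := by
    rw [← hS]
    have h1 : ℓ ≤ ε / (2 * (S + 1)) := by rw [hℓ]; exact min_le_right _ _
    have h2 : ℓ * S ≤ ε / (2 * (S + 1)) * S := mul_le_mul_of_nonneg_right h1 hS0
    have h3 : ε / (2 * (S + 1)) * S < ε := by
      rw [div_mul_eq_mul_div, div_lt_iff₀ (by positivity)]
      nlinarith
    exact lt_of_le_of_lt h2 h3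
  -- the cross theorem at scale `ℓ`
  obtain ⟨r', hr', hcross⟩ :=
    Literature.Analysis.Complex.exists_holomorphic_extension_of_separately_local_fintype (ι := Fin 4) ℓ hℓpos
  set P : (Fin 4 → ℝ) → ℂ := fun y => ((f (x₀ + ∑ j, y j • v j) : ℝ) : ℂ) with hP
  have hPb : ∀ y : Fin 4 → ℝ, (∀ k, |y k| < ℓ) → ‖P y‖ ≤ M := by
    intro y hy
    obtain ⟨F, -, hFr, hFb⟩ := hext (x₀ + ∑ j, y j • v j) (dist_sum_smul_lt v x₀ hℓε y fun j => (hy j).le) 0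
    have h1 := hFr 0 (by simpa using hr)
    rw [Complex.ofReal_zero, zero_smul, add_zero] at h1
    have h2 := hFb 0 (mem_ball_self hr)
    rw [h1] at h2
    simpa [hP] using h2
  have hPext : ∀ (k : Fin 4) (y : Fin 4 → ℝ), (∀ j, |y j| < ℓ) → ∃ g : ℂ → ℂ,
      DifferentiableOn ℂ g (ball (0 : ℂ) ℓ) ∧ (∀ w ∈ ball (0 : ℂ) ℓ, ‖g w‖ ≤ M) ∧
      ∀ t : ℝ, |t| < ℓ → g t = P (Function.update y k t) := by
    intro k y hy
    have hc : ∀ j, |Function.update y k 0 j| ≤ ℓ := by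
      intro j
      rcases eq_or_ne j k with hj | hj
      · subst hj; simp [hℓpos.le]
      · rw [Function.update_of_ne hj]; exact (hy j).le
    obtain ⟨F, hFd, hFr, hFb⟩ := hext (x₀ + ∑ j, Function.update y k 0 j • v j) (dist_sum_smul_lt v x₀ hℓε _ hc) k
    refine ⟨F, hFd.mono (ball_subset_ball hℓr), fun w hw => hFb w (ball_subset_ball hℓr hw), fun t ht => ?_⟩
    rw [hFr t (lt_of_lt_of_le ht hℓr)]
    simp only [hP]
    rw [sum_update_smul v y k t, add_assoc]
  obtain ⟨G, hGd, -, hGr⟩ := hcross M P hPb hPext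
  -- the chart lemma with the basis `v`
  obtain ⟨bs, hbs⟩ : ∃ bs : Module.Basis (Fin 4) ℝ E4, ∀ j, bs j = v j :=
    ⟨basisOfLinearIndependentOfCardEqFinrank hv (by simp), fun j => by
      rw [coe_basisOfLinearIndependentOfCardEqFinrank]⟩
  refine Literature.Analysis.Complex.analyticAt_of_holomorphic_chart_fintype bs hr' hGd fun t ht => ?_
  rw [hGr t ht]
  simp only [hP, hbs]

end Summit.QuantumFields.YangMills.Theorems.F4SubCurvatureDoorCrossAnalyticityRegistered

end
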